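import Summits.Ventures.WeilGRH.CharacterFamilyFlatTest
import Mathlib.NumberTheory.MulChar.Lemmas
import HarnessLib

/-!
# GRH arm (rh-explicit, venture WeilGRH): WEIGHTED character families — primes in the progression
  `u mod q` below the horizon, and the maximal real subfield (Odlyzko's constant `8πe^{γ+π/2}`)

Cell `rh-explicit`, WEIL TRACK (structure seat weil-3, gen8).  Sequel of `CharacterFamilyFlatTest.lean`,
where the flat-window inequalities of ALL characters mod `q` were summed with weight `1`.  Here they are
summed with the NON-NEGATIVE weights

  `w_χ = 1 + Re χ(u)`   (`u` a unit mod `q`; `0 ≤ w_χ ≤ 2`),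

for which orthogonality gives (`sum_weight_mul_re_char`)

  `Σ_χ w_χ Re χ(n) = φ(q)·(𝟙[n ≡ 1] + ½𝟙[n ≡ u] + ½𝟙[u·n ≡ 1])   (mod q)`,

again non-negative at every prime power: so the family of rungs at one window bounds the primes in the
class `u` (and `u⁻¹`) below the horizon (`progression_flatWindow_le_of_characterFamily`,
`progression_flatSum_le_of_characterFamily`):

  `φ(q)·Σ_{log n<2a, n≡u (q)} Λ(n)n^{-1/2}(1 − log n/(2a)) ≤ (φ(q) − 2) log q + 32 sinh²(a/2)/a − φ(q)(2.23 − 5/a)`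

— a one-sided Brun–Titchmarsh / prime-number-theorem-in-progressions statement at GRH strength, by
POSITIVITY (under `RH` + `GRH` for a prime modulus: every window, `…_of_grh`).

The unit `u = −1` is special (`w_χ = 1 + χ(−1) = 2·𝟙[χ even]`: only the EVEN characters — those of the
maximal real subfield `ℚ(ζ_q)⁺` — are used, and the even constant `K₀ = log 8π + γ + π/2`,
`e^{K₀} = 8πe^{γ+π/2} = 215.33…` = Odlyzko's totally real GRH constant, appears alone): see the sequel
`EvenCharacterFamilyFlatTest.lean`.

No definitions, no named facts, RH/GRH-free except the `_of_grh` corollary (hypotheses).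

## References

* A. M. Odlyzko, *Bounds for discriminants and related estimates for class numbers, regulators and zeros
  of zeta functions: a survey of recent results*, Sém. Théor. Nombres Bordeaux 2 (1990) 119–141,
  (2.5)–(2.8). [Odlyzko1990Bounds]
* G. Poitou, *Sur les petits discriminants*, Sém. Delange–Pisot–Poitou 18 (1976/77) no. 6.
  [Poitou1977Discriminants]
* A. Weil, *Sur les "formules explicites" de la théorie des nombres premiers* (1952), (11) pp. 261–262.
  [Weil1952FormulesExplicites]
* H. L. Montgomery, R. C. Vaughan, *Multiplicative Number Theory I* (2007), §4.3, Thm. 13.11.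
  [MontgomeryVaughan2007]
-/

set_option autoImplicit false

noncomputable section

open Complex Filter Set MeasureTheory
open scoped Real Topology ComplexConjugate ArithmeticFunction.vonMangoldt

namespace Summit.Ventures.WeilGRH

open Literature.NumberTheory.LFunctions

variable {q : ℕ} {a : ℝ}

/-! ## The weights `1 + Re χ(u)` and their orthogonality -/

/-- `Re z · Re w = (Re(z w) + Re(conj z · w))/2` for complex `z, w`. -/
theorem re_mul_re_eq_half (z w : ℂ) : z.re * w.re = ((z * w).re + (conj z * w).re) / 2 := by
  simp only [Complex.mul_re, Complex.conj_re, Complex.conj_im]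
  ring

/-- `conj χ(u) = χ(u⁻¹)` for a unit `u` mod `q` (the values on units are roots of unity). -/
theorem conj_char_unit [NeZero q] (χ : DirichletCharacter ℂ q) (u : (ZMod q)ˣ) :
    conj (χ (u : ZMod q)) = χ ((u⁻¹ : (ZMod q)ˣ) : ZMod q) := by
  have h := MulChar.star_apply' χ (u : ZMod q)
  rw [RCLike.star_def] at h
  rw [h, MulChar.inv_apply, Ring.inverse_unit]

/-- The weight is non-negative: `0 ≤ 1 + Re χ(x)` (`‖χ(x)‖ ≤ 1`). -/
theorem weight_nonneg (χ : DirichletCharacter ℂ q) (x : ZMod q) : 0 ≤ 1 + (χ x).re := by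
  have h1 := DirichletCharacter.norm_le_one χ x
  have h2 := Complex.abs_re_le_norm (χ x)
  have h3 := neg_abs_le (χ x).re
  linarith

/-- **Weighted orthogonality**: for a unit `u` mod `q` and any `x ∈ ZMod q`,
`Σ_χ (1 + Re χ(u))·Re χ(x) = φ(q)·(𝟙[x = 1] + ½·𝟙[u·x = 1] + ½·𝟙[x = u])`. -/
theorem sum_weight_mul_re_char [NeZero q] (u : (ZMod q)ˣ) (x : ZMod q) :
    ∑ χ : DirichletCharacter ℂ q, (1 + (χ (u : ZMod q)).re) * (χ x).re =
      (q.totient : ℝ) * ((if x = 1 then 1 else 0) + (if (u : ZMod q) * x = 1 then 1 / 2 else 0) +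
        (if x = u then 1 / 2 else 0)) := by
  have hterm : ∀ χ : DirichletCharacter ℂ q, (1 + (χ (u : ZMod q)).re) * (χ x).re =
      (χ x).re + ((χ ((u : ZMod q) * x)).re + (χ (((u⁻¹ : (ZMod q)ˣ) : ZMod q) * x)).re) / 2 := by
    intro χ
    rw [add_mul, one_mul, re_mul_re_eq_half, conj_char_unit, ← map_mul, ← map_mul]
  simp_rw [hterm]
  rw [Finset.sum_add_distrib, ← Finset.sum_div, Finset.sum_add_distrib, ← Complex.re_sum, ← Complex.re_sum,
    ← Complex.re_sum, re_sum_characters_apply, re_sum_characters_apply, re_sum_characters_apply]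
  have hiff : ((u⁻¹ : (ZMod q)ˣ) : ZMod q) * x = 1 ↔ x = u := by
    rw [Units.inv_mul_eq_iff_eq_mul, mul_one]
  simp only [hiff]
  split_ifs <;> ring

/-- The total weight is `φ(q)` when `u ≠ 1`: `Σ_χ (1 + Re χ(u)) = φ(q)`. -/
theorem sum_weight_eq [NeZero q] {u : (ZMod q)ˣ} (hu : (u : ZMod q) ≠ 1) :
    ∑ χ : DirichletCharacter ℂ q, (1 + (χ (u : ZMod q)).re) = (q.totient : ℝ) := by
  rw [Finset.sum_add_distrib, Finset.sum_const, card_dirichletCharacter_eq_totient, nsmul_eq_mul, mul_one,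
    ← Complex.re_sum, re_sum_characters_apply, if_neg hu, add_zero]

/-- The principal character has weight `2`: `1 + Re 1(u) = 2`. -/
theorem weight_one (u : (ZMod q)ˣ) : 1 + ((1 : DirichletCharacter ℂ q) (u : ZMod q)).re = 2 := by
  rw [MulChar.one_apply_coe]; norm_num

/-! ## The weighted family inequality -/

/-- **THE WEIGHTED CHARACTER-FAMILY INEQUALITY** (`q ≠ 1`, `a > 0`, `u` a unit mod `q` with `u ≠ 1`).
If `WeilPositivityOn a` and `WeilPositivityOnChar χ a` for every non-principal `χ` mod `q`, then, summing
the flat-window inequalities with the weights `1 + Re χ(u) ≥ 0`: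

  `2φ(q)·Σ_{n≡1} c_n + φ(q)·Σ_{u·n≡1} c_n + φ(q)·Σ_{n≡u} c_n + Σ_χ (1 + Re χ(u))·[K_{κ(χ)} − I_{κ(χ)}(a)/a]`
    `≤ (φ(q) − 2)·log q + 32 sinh²(a/2)/a`,

`c_n = Λ(n)n^{-1/2}(1 − log n/(2a))` over `log n < 2a`: the prime powers in the classes `1`, `u`, `u⁻¹`
enter with POSITIVE weights, all others drop out.  RH/GRH-free. -/
theorem progression_flatWindow_le_of_characterFamily [NeZero q] (hq : q ≠ 1) (ha : 0 < a)
    (hζ : WeilPositivityOn a) (hχ : ∀ χ : DirichletCharacter ℂ q, χ ≠ 1 → WeilPositivityOnChar χ a)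
    (u : (ZMod q)ˣ) (hu : (u : ZMod q) ≠ 1) :
    2 * (q.totient : ℝ) * (∑ n ∈ (weilPrimeIndex a).filter (fun n : ℕ ↦ (n : ZMod q) = 1),
          (Λ n : ℝ) / Real.sqrt n * (1 - Real.log n / (2 * a))) +
        (q.totient : ℝ) * (∑ n ∈ (weilPrimeIndex a).filter (fun n : ℕ ↦ (u : ZMod q) * (n : ZMod q) = 1),
          (Λ n : ℝ) / Real.sqrt n * (1 - Real.log n / (2 * a))) +
        (q.totient : ℝ) * (∑ n ∈ (weilPrimeIndex a).filter (fun n : ℕ ↦ (n : ZMod q) = u),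
          (Λ n : ℝ) / Real.sqrt n * (1 - Real.log n / (2 * a))) +
        ∑ χ : DirichletCharacter ℂ q, (1 + (χ (u : ZMod q)).re) *
          ((Real.log (4 * π) + Real.eulerMascheroniConstant +
              2 * ∫ t in Ioi (0 : ℝ), weilKillingDensityPar (charParity χ) t) -
            1 / a * ∫ t in Ioi (0 : ℝ), weilArchDensityPar (charParity χ) t * min t (2 * a)) ≤
      ((q.totient : ℝ) - 2) * Real.log q + 32 * Real.sinh (a / 2) ^ 2 / a := by
  classical
  set c : ℕ → ℝ := fun n ↦ (Λ n : ℝ) / Real.sqrt n * (1 - Real.log n / (2 * a)) with hc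
  set K : DirichletCharacter ℂ q → ℝ := fun χ ↦
    (Real.log (4 * π) + Real.eulerMascheroniConstant +
        2 * ∫ t in Ioi (0 : ℝ), weilKillingDensityPar (charParity χ) t) -
      1 / a * ∫ t in Ioi (0 : ℝ), weilArchDensityPar (charParity χ) t * min t (2 * a) with hK
  set B : DirichletCharacter ℂ q → ℝ := fun χ ↦
    if χ = 1 then 16 * Real.sinh (a / 2) ^ 2 / a else Real.log q with hB
  set w : DirichletCharacter ℂ q → ℝ := fun χ ↦ 1 + (χ (u : ZMod q)).re with hw
  -- weighted slots
  have hslot : ∀ χ : DirichletCharacter ℂ q,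
      w χ * (2 * (∑ n ∈ weilPrimeIndex a, c n * (χ (n : ZMod q)).re) + K χ) ≤ w χ * B χ := by
    intro χ
    have h := flatWindow_le_slot hq ha hζ hχ χ
    have hs : ∑ n ∈ weilPrimeIndex a, c n * (χ (n : ZMod q)).re =
        ∑ n ∈ weilPrimeIndex a, (Λ n : ℝ) / Real.sqrt n *
          ((1 - Real.log n / (2 * a)) * (χ (n : ZMod q)).re) :=
      Finset.sum_congr rfl fun n _ ↦ by simp only [hc]; ring
    refine mul_le_mul_of_nonneg_left ?_ (weight_nonneg χ _)
    rw [hs]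
    simpa only [hK, hB, add_sub_assoc'] using h
  -- the weighted right-hand sides
  have hsumB : ∑ χ : DirichletCharacter ℂ q, w χ * B χ =
      ((q.totient : ℝ) - 2) * Real.log q + 32 * Real.sinh (a / 2) ^ 2 / a := by
    have hB' : ∀ χ : DirichletCharacter ℂ q, w χ * B χ =
        w χ * Real.log q + if χ = 1 then w χ * (16 * Real.sinh (a / 2) ^ 2 / a - Real.log q) else 0 := by
      intro χ
      simp only [hB]
      split_ifs <;> ring
    simp_rw [hB']
    rw [Finset.sum_add_distrib, ← Finset.sum_mul, Finset.sum_ite_eq' Finset.univ (1 : DirichletCharacter ℂ q),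
      if_pos (Finset.mem_univ _)]
    simp only [hw]
    rw [sum_weight_eq hu, weight_one]
    ring
  -- the weighted prime sides
  have hsumP : ∑ χ : DirichletCharacter ℂ q, w χ * ∑ n ∈ weilPrimeIndex a, c n * (χ (n : ZMod q)).re =
      (q.totient : ℝ) * ((∑ n ∈ (weilPrimeIndex a).filter (fun n : ℕ ↦ (n : ZMod q) = 1), c n) +
        (∑ n ∈ (weilPrimeIndex a).filter (fun n : ℕ ↦ (u : ZMod q) * (n : ZMod q) = 1), c n) / 2 +
        (∑ n ∈ (weilPrimeIndex a).filter (fun n : ℕ ↦ (n : ZMod q) = u), c n) / 2) := by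
    simp_rw [Finset.mul_sum]
    rw [Finset.sum_comm]
    have hin : ∀ n ∈ weilPrimeIndex a,
        ∑ χ : DirichletCharacter ℂ q, w χ * (c n * (χ (n : ZMod q)).re) =
          (q.totient : ℝ) * (c n * ((if (n : ZMod q) = 1 then 1 else 0) +
            (if (u : ZMod q) * (n : ZMod q) = 1 then 1 / 2 else 0) +
            (if (n : ZMod q) = (u : ZMod q) then 1 / 2 else 0))) := by
      intro n _
      have : ∀ χ : DirichletCharacter ℂ q, w χ * (c n * (χ (n : ZMod q)).re) =
          c n * ((1 + (χ (u : ZMod q)).re) * (χ (n : ZMod q)).re) := fun χ ↦ by simp only [hw]; ring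
      simp_rw [this]
      rw [← Finset.mul_sum, sum_weight_mul_re_char]
      ring
    rw [Finset.sum_congr rfl hin, ← Finset.mul_sum]
    congr 1
    simp_rw [mul_add, Finset.sum_add_distrib, mul_ite, mul_one, mul_zero, Finset.sum_ite, Finset.sum_const_zero,
      add_zero]
    rw [Finset.sum_div, Finset.sum_div]
    simp_rw [mul_one_div]
  have htot := Finset.sum_le_sum fun χ (_ : χ ∈ (Finset.univ : Finset (DirichletCharacter ℂ q))) ↦ hslot χ
  simp_rw [mul_add] at htot
  rw [Finset.sum_add_distrib] at htot
  have h2 : ∑ χ : DirichletCharacter ℂ q, w χ * (2 * ∑ n ∈ weilPrimeIndex a, c n * (χ (n : ZMod q)).re) =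
      2 * ∑ χ : DirichletCharacter ℂ q, w χ * ∑ n ∈ weilPrimeIndex a, c n * (χ (n : ZMod q)).re := by
    rw [Finset.mul_sum]
    exact Finset.sum_congr rfl fun χ _ ↦ by ring
  rw [h2, hsumP, hsumB] at htot
  have hφ : (0 : ℝ) ≤ q.totient := Nat.cast_nonneg _
  simp only [hw, hK] at htot
  linarith

/-- **PRIMES `≡ u (mod q)` FROM POSITIVITY, with numbers** (`q ≠ 1`, `a > 0`, `u ≠ 1` a unit mod `q`):
if every character mod `q` has its rung at `a` (`ζ` included), then

  `Σ_{log n<2a, n≡u (q)} Λ(n) n^{-1/2} (1 − log n/(2a))`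
    `≤ (1 − 2/φ(q))·log q + 32 sinh²(a/2)/(φ(q)·a) − (2.23 − 5/a)`

(the classes `1` and `u⁻¹` dropped, `K_κ − I_κ(a)/a ≥ 2.23 − 5/a`, total weight `φ(q)`).  With `x = e^{2a}`
the main term is `16(√x − 2 + x^{-1/2})/(φ(q) log x)` — Brun–Titchmarsh at the square-root scale with the
GRH-type `log q`, one-sided, from the rungs at ONE window. -/
theorem progression_flatSum_le_of_characterFamily [NeZero q] (hq : q ≠ 1) (ha : 0 < a)
    (hζ : WeilPositivityOn a) (hχ : ∀ χ : DirichletCharacter ℂ q, χ ≠ 1 → WeilPositivityOnChar χ a)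
    (u : (ZMod q)ˣ) (hu : (u : ZMod q) ≠ 1) :
    ∑ n ∈ (weilPrimeIndex a).filter (fun n : ℕ ↦ (n : ZMod q) = u),
        (Λ n : ℝ) / Real.sqrt n * (1 - Real.log n / (2 * a)) ≤
      (1 - 2 / q.totient) * Real.log q + 32 * Real.sinh (a / 2) ^ 2 / (q.totient * a) - (2.23 - 5 / a) := by
  classical
  have h := progression_flatWindow_le_of_characterFamily hq ha hζ hχ u hu
  have hφ : (0 : ℝ) < q.totient := by exact_mod_cast Nat.totient_pos.2 (NeZero.pos q)
  -- the archimedean constants, weighted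
  have hK : (q.totient : ℝ) * (2.23 - 5 / a) ≤
      ∑ χ : DirichletCharacter ℂ q, (1 + (χ (u : ZMod q)).re) *
        ((Real.log (4 * π) + Real.eulerMascheroniConstant +
            2 * ∫ t in Ioi (0 : ℝ), weilKillingDensityPar (charParity χ) t) -
          1 / a * ∫ t in Ioi (0 : ℝ), weilArchDensityPar (charParity χ) t * min t (2 * a)) := by
    rw [← sum_weight_eq hu, Finset.sum_mul]
    refine Finset.sum_le_sum fun χ _ ↦ mul_le_mul_of_nonneg_left ?_ (weight_nonneg χ _)
    have h1 := flatWindow_archConst_ge ha χ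
    have h2 : (2.23 : ℝ) ≤ if χ.Even then (5.3716 : ℝ) else 2.23 := by split_ifs <;> norm_num
    linarith
  -- the two dropped classes are non-negative
  have hS1 : 0 ≤ ∑ n ∈ (weilPrimeIndex a).filter (fun n : ℕ ↦ (n : ZMod q) = 1),
      (Λ n : ℝ) / Real.sqrt n * (1 - Real.log n / (2 * a)) :=
    Finset.sum_nonneg fun n hn ↦ flatSum_term_nonneg ha (Finset.mem_of_mem_filter n hn)
  have hS2 : 0 ≤ ∑ n ∈ (weilPrimeIndex a).filter (fun n : ℕ ↦ (u : ZMod q) * (n : ZMod q) = 1),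
      (Λ n : ℝ) / Real.sqrt n * (1 - Real.log n / (2 * a)) :=
    Finset.sum_nonneg fun n hn ↦ flatSum_term_nonneg ha (Finset.mem_of_mem_filter n hn)
  set S := ∑ n ∈ (weilPrimeIndex a).filter (fun n : ℕ ↦ (n : ZMod q) = u),
      (Λ n : ℝ) / Real.sqrt n * (1 - Real.log n / (2 * a))
  have hmain : (q.totient : ℝ) * S ≤ ((q.totient : ℝ) - 2) * Real.log q + 32 * Real.sinh (a / 2) ^ 2 / a -
      (q.totient : ℝ) * (2.23 - 5 / a) := by nlinarith
  have : S ≤ (((q.totient : ℝ) - 2) * Real.log q + 32 * Real.sinh (a / 2) ^ 2 / a -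
      (q.totient : ℝ) * (2.23 - 5 / a)) / q.totient := by
    rw [le_div_iff₀ hφ]; linarith
  refine this.trans_eq ?_
  field_simp

/-- **`RH` + `GRH(χ)` for every `χ` mod a prime `p` ⟹ the progression bound at EVERY window**: for every
unit `u ≢ 1 (mod p)` and every `a > 0`,
`Σ_{log n<2a, n≡u (p)} Λ(n)n^{-1/2}(1 − log n/(2a)) ≤ (1 − 2/(p−1)) log p + 32 sinh²(a/2)/((p−1)a) − 2.23 + 5/a`. -/
theorem progression_flatSum_le_of_grh {p : ℕ} [NeZero p] (hp : p.Prime) (hRH : RiemannHypothesis)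
    (hGRH : ∀ χ : DirichletCharacter ℂ p, χ ≠ 1 → χ.RiemannHypothesis) (ha : 0 < a)
    (u : (ZMod p)ˣ) (hu : (u : ZMod p) ≠ 1) :
    ∑ n ∈ (weilPrimeIndex a).filter (fun n : ℕ ↦ (n : ZMod p) = u),
        (Λ n : ℝ) / Real.sqrt n * (1 - Real.log n / (2 * a)) ≤
      (1 - 2 / p.totient) * Real.log p + 32 * Real.sinh (a / 2) ^ 2 / (p.totient * a) - (2.23 - 5 / a) := by
  have hp1 : p ≠ 1 := hp.ne_one
  refine progression_flatSum_le_of_characterFamily hp1 ha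
    (riemannHypothesis_iff_forall_weilPositivityOn.1 hRH a ha) (fun χ hχ ↦ ?_) u hu
  have hprim : χ.IsPrimitive := by
    rw [DirichletCharacter.isPrimitive_def]
    rcases (Nat.dvd_prime hp).1 χ.conductor_dvd_level with h | h
    · exact absurd (DirichletCharacter.eq_one_iff_conductor_eq_one.2 h) hχ
    · exact h
  exact (WeilPositivityChar.of_grh hp1 hprim (hGRH χ hχ)).on a

end Summit.Ventures.WeilGRH

end
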